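import Mathlib.Combinatorics.Pigeonhole
import Summits.CriticalPhenomena.SAWScalingLimit.Theorems.SAWLeftRightFKGFKGToTraversalBoundSlitNecklacePieces
import HarnessLib

/-!
# Slit necklace, step D3: the necklace bookkeeping (crux `FKGToTraversalBound`, stmt-CriticalPhenomena-1878)

Line `slit-necklace`, reshape r3, registered stub `stub_necklaceBookkeeping : NecklaceBookkeeping`
(chart `Cruxes/FKGToTraversalBound/Lines/slit-necklace-chart-r2.md`, step D3).  Deterministic
bookkeeping of the index windows of a self-avoiding lattice walk `p` from the blob `Ka` to the blob
`Kb`, spine `Ka ∪ Kb ∪ S`: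

1. `2M` separate traversals of `D(x; ρ, R)` by the mesh polyline give `M` strictly separated index
   windows across `D(x; ρ + δ, R - δ)` (`ShellIteration.exists_sepIndexTraversals_of_hasTraversals_toCurve`);
2. windows through a defect index are `≤ #S` (the walk is a path, the windows are disjoint);
   windows through a blob index contain a window across the germ shell `D(ca; ιa, η)` (the band of
   the shell is `2η`-far from the marked centres), so `g` of them give `g` separate germ traversals;
3. the remaining windows avoid the spine, hence lie strictly inside a piece, which is far by a
   discrete intermediate value (an interior index lands in the band);
4. far pieces are hung on a defect (`≤ 2 #S` of them, pieces being determined by either end) or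
   carry a germ window from their blob end (`< g` of each kind);
5. pigeonhole: some far piece carries `n₁ + 1` of the remaining windows.

Only theorems; axioms are the standard three.
-/

noncomputable section

open MeasureTheory Filter Topology Set Metric
open scoped NNReal ENNReal
open Literature.Probability.LatticeModels
open Literature.Probability.RandomPlanarGeometry
open Literature.Probability.RandomPlanarGeometry.SAW
open Summit.CriticalPhenomena.SAWScalingLimit.Theses.SAWLeftRightFKG
open Summit.CriticalPhenomena.SAWScalingLimit.Theorems.FKGToTraversalBound.ExcursionDomination.ShellIteration

namespace Summit.CriticalPhenomena.SAWScalingLimit.Theorems.FKGToTraversalBound.SlitNecklace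

section Generic

variable {V : Type*} {G : SimpleGraph V} {u v : V} {E : Type*} [PseudoMetricSpace E]

/-- **Far end of a window through a blob index.**  If `z` is within `ι < η` of the centre `c`, the
closed band `ρ ≤ |· - x| ≤ R` is `2η`-far from `c` at `z`, `2η + δ ≤ R - ρ`, and `w₁`, `w₂` lie on
opposite sides of `D(x; ρ + δ, R - δ)`, then one of `w₁`, `w₂` is at distance `≥ η` from `c`.
[folklore] -/
private theorem far_end {z w₁ w₂ c x : E} {ι η ρ R δ : ℝ} (hz : dist z c ≤ ι) (hι : ι < η)
    (hηR : 2 * η + δ ≤ R - ρ) (hband : ρ ≤ dist z x → dist z x ≤ R → 2 * η ≤ dist z c)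
    (h₁ : dist w₁ x ≤ ρ + δ) (h₂ : R - δ ≤ dist w₂ x) : η ≤ dist w₁ c ∨ η ≤ dist w₂ c := by
  rcases le_or_gt η (dist w₁ c) with hw₁ | hw₁
  · exact Or.inl hw₁
  rcases le_or_gt η (dist w₂ c) with hw₂ | hw₂
  · exact Or.inr hw₂
  exfalso
  have t1 := dist_triangle c z x
  have t2 := dist_triangle z c x
  have t3 := dist_triangle w₂ c x
  have t4 := dist_triangle c w₁ x
  have e1 := dist_comm c z
  have e2 := dist_comm c w₁
  have h0 := dist_nonneg (x := w₁) (y := c)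
  rcases lt_or_ge (dist z x) ρ with hρ | hρ
  · linarith
  rcases le_or_gt (dist z x) R with hR | hR
  · have := hband hρ hR
    linarith
  · linarith

/-- Pieces are disjoint: a piece starting strictly after the start of another starts after its end.
[folklore] -/
private theorem isPiece_le_of_lt {p : G.Walk u v} {Sp : Set V} {i j i' j' : ℕ} (h : IsPiece p Sp i j)
    (h' : IsPiece p Sp i' j') (hii' : i < i') : j ≤ i' := by
  by_contra hlt
  exact h.2.2.2 i' hii' (not_le.1 hlt) h'.1.2

/-- The right end of a piece is determined by its left end. [folklore] -/
private theorem isPiece_right_unique {p : G.Walk u v} {Sp : Set V} {i j j' : ℕ} (h : IsPiece p Sp i j)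
    (h' : IsPiece p Sp i j') : j = j' := by
  by_contra hne
  rcases lt_or_gt_of_ne hne with hlt | hlt
  · exact h'.2.2.2 j (by have := h.2.2.1; omega) hlt h.2.1.2
  · exact h.2.2.2 j' (by have := h'.2.2.1; omega) hlt h'.2.1.2

/-- The left end of a piece is determined by its right end. [folklore] -/
private theorem isPiece_left_unique {p : G.Walk u v} {Sp : Set V} {i i' j : ℕ} (h : IsPiece p Sp i j)
    (h' : IsPiece p Sp i' j) : i = i' := by
  by_contra hne
  rcases lt_or_gt_of_ne hne with hlt | hlt
  · exact h.2.2.2 i' hlt (by have := h'.2.2.1; omega) h'.1.2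
  · exact h'.2.2.2 i hlt (by have := h.2.2.1; omega) h.1.2

/-- **Enumeration.**  Windows indexed by a finite subset of a linear order, strictly separated along
the order, are `#F` strictly separated index windows (enumerate increasingly by
`Finset.orderEmbOfFin`). [folklore] -/
private theorem hasSepWindows_of_finset {α : Type*} [LinearOrder α] (F : Finset α) (emb : V → E)
    (p : G.Walk u v) (a b : α → ℕ) {lo hi : ℕ} {y : E} {σ₁ σ₂ : ℝ}
    (hab : ∀ m ∈ F, lo ≤ a m ∧ a m ≤ b m ∧ b m ≤ hi)
    (hside : ∀ m ∈ F, (dist (emb (p.getVert (a m))) y ≤ σ₁ ∧ σ₂ ≤ dist (emb (p.getVert (b m))) y) ∨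
      (σ₂ ≤ dist (emb (p.getVert (a m))) y ∧ dist (emb (p.getVert (b m))) y ≤ σ₁))
    (hsep : ∀ m ∈ F, ∀ m' ∈ F, m < m' → b m < a m') :
    HasSepWindows emb p F.card lo hi y σ₁ σ₂ :=
  ⟨a ∘ F.orderEmbOfFin rfl, b ∘ F.orderEmbOfFin rfl, fun m => hab _ (F.orderEmbOfFin_mem rfl m),
    fun m => hside _ (F.orderEmbOfFin_mem rfl m), fun _ _ hmm' =>
      hsep _ (F.orderEmbOfFin_mem rfl _) _ (F.orderEmbOfFin_mem rfl _)
        ((F.orderEmbOfFin rfl).strictMono hmm')⟩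

/-- **Counting by finite sub-families.**  If every finite subset `T` of a finite set `s ⊆ ℕ`
satisfies `P #T` while `P g` fails, then `s` has fewer than `g` elements. [folklore] -/
private theorem ncard_lt_of_forall_finset {s : Set ℕ} (hs : s.Finite) {g : ℕ} {P : ℕ → Prop}
    (hP : ∀ T : Finset ℕ, (↑T : Set ℕ) ⊆ s → P T.card) (hg : ¬ P g) : s.ncard < g := by
  by_contra h
  obtain ⟨t, hts, htc⟩ := Set.exists_subset_card_eq (not_lt.1 h)
  have ht : t.Finite := hs.subset hts
  refine hg ?_
  have := hP ht.toFinset (by rwa [ht.coe_toFinset])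
  rwa [← Set.ncard_eq_toFinset_card t ht, htc] at this

/-- **A spine-free window lies strictly inside a piece.**  If the first and the last index of `p` are
spine indices and the window `[a, b]`, `b ≤ p.length`, contains no spine index, then the largest
spine index `i < a` and the least spine index `j > b` delimit a piece. [folklore] -/
private theorem exists_piece_of_window (p : G.Walk u v) {Sp : Set V} (h0 : p.getVert 0 ∈ Sp)
    (hlen : p.getVert p.length ∈ Sp) {a b : ℕ} (hab : a ≤ b) (hb : b ≤ p.length)
    (hpure : ∀ n, a ≤ n → n ≤ b → p.getVert n ∉ Sp) :
    ∃ i j, IsPiece p Sp i j ∧ i < a ∧ b < j := by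
  classical
  have hbl : b < p.length := lt_of_le_of_ne hb fun h => hpure b hab le_rfl (h ▸ hlen)
  have hP0 : IsSpineIdx p Sp 0 := ⟨Nat.zero_le _, h0⟩
  have hi : IsSpineIdx p Sp (Nat.findGreatest (IsSpineIdx p Sp) b) :=
    Nat.findGreatest_spec (Nat.zero_le b) hP0
  have hib : Nat.findGreatest (IsSpineIdx p Sp) b ≤ b := Nat.findGreatest_le b
  have hia : Nat.findGreatest (IsSpineIdx p Sp) b < a := by
    by_contra h
    exact hpure _ (not_lt.1 h) hib hi.2
  have hex : ∃ n, b < n ∧ IsSpineIdx p Sp n := ⟨p.length, hbl, le_rfl, hlen⟩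
  have hj : b < Nat.find hex ∧ IsSpineIdx p Sp (Nat.find hex) := Nat.find_spec hex
  refine ⟨_, _, ⟨hi, hj.2, by omega, fun n hin hnj hn => ?_⟩, hia, hj.1⟩
  have hnl : n ≤ p.length := hnj.le.trans hj.2.1
  rcases le_or_gt n b with hnb | hbn
  · exact Nat.findGreatest_is_greatest hin hnb ⟨hnl, hn⟩
  · exact Nat.find_min hex hnj ⟨hbn, hnl, hn⟩

/-- **Windows through a defect index are few.**  Along a path, disjoint index windows each containing
an index whose vertex lies in the finite set `S` are at most `#S` many (the vertices are distinct).
[folklore] -/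
private theorem card_defectWindows_le {p : G.Walk u v} (hp : p.IsPath) {M : ℕ} {a b : Fin M → ℕ}
    (hb : ∀ m, b m ≤ p.length) (hsep : ∀ ⦃m m' : Fin M⦄, m < m' → b m < a m') (S : Finset V)
    (F : Finset (Fin M)) (hF : ∀ m ∈ F, ∃ n, a m ≤ n ∧ n ≤ b m ∧ p.getVert n ∈ S) :
    F.card ≤ S.card := by
  choose! n han hnb hnS using hF
  refine Finset.card_le_card_of_injOn (fun m => p.getVert (n m)) (fun m hm => by simpa using hnS m hm)
    fun m hm m' hm' h => ?_
  have he : n m = n m' :=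
    hp.getVert_injOn (show n m ≤ p.length from (hnb m hm).trans (hb m)) ((hnb m' hm').trans (hb m')) h
  by_contra hne
  rcases lt_or_gt_of_ne hne with hlt | hlt
  · have h1 := hsep hlt
    have h2 := hnb m hm
    have h3 := han m' hm'
    omega
  · have h1 := hsep hlt
    have h2 := hnb m' hm'
    have h3 := han m hm
    omega

end Generic

/-! ### Windows and pieces of a lattice walk at mesh `δ` -/

variable {δ : ℝ} {G : SimpleGraph (Site 2)} {u v : Site 2}

/-- **Windows through a blob index are charged to the germ shell.**  Strictly separated index windows
across `D(x; ρ + δ, R - δ)` each containing an index whose site lies in the blob `K` (sites within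
`ι < η` of `c`, the band of `D(x; ρ, R)` being `2η`-far from `c`) each contain a window across the
germ shell `D(c; ι, η)`; so fewer than `g` of them, unless the mesh polyline makes `g` separate
traversals of the germ shell. [folklore] -/
private theorem card_blobWindows_lt (p : G.Walk u v) {M : ℕ} {a b : Fin M → ℕ} {x c : ℂ}
    {ρ R ι η : ℝ} {g : ℕ} (K : Finset (Site 2)) (hb : ∀ m, b m ≤ p.length)
    (hside : ∀ m, (dist (meshPoint δ (p.getVert (a m))) x ≤ ρ + δ ∧
        R - δ ≤ dist (meshPoint δ (p.getVert (b m))) x) ∨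
      (R - δ ≤ dist (meshPoint δ (p.getVert (a m))) x ∧ dist (meshPoint δ (p.getVert (b m))) x ≤ ρ + δ))
    (hsep : ∀ ⦃m m' : Fin M⦄, m < m' → b m < a m') (hK : ∀ k ∈ K, dist (meshPoint δ k) c ≤ ι)
    (hι : ι < η) (hηR : 2 * η + δ ≤ R - ρ)
    (hband : ∀ z : ℂ, ρ ≤ dist z x → dist z x ≤ R → 2 * η ≤ dist z c)
    (hg : ¬ (⟨p.toCurve (meshPoint δ)⟩ : Curve ℂ).HasTraversals g c ι η) (F : Finset (Fin M))
    (hF : ∀ m ∈ F, ∃ n, a m ≤ n ∧ n ≤ b m ∧ p.getVert n ∈ K) : F.card < g := by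
  have key : ∀ m ∈ F, ∃ i j, a m ≤ i ∧ i ≤ j ∧ j ≤ b m ∧
      ((dist (meshPoint δ (p.getVert i)) c ≤ ι ∧ η ≤ dist (meshPoint δ (p.getVert j)) c) ∨
        (η ≤ dist (meshPoint δ (p.getVert i)) c ∧ dist (meshPoint δ (p.getVert j)) c ≤ ι)) := by
    intro m hm
    obtain ⟨n, han, hnb, hn⟩ := hF m hm
    rcases hside m with ⟨h1, h2⟩ | ⟨h1, h2⟩
    · rcases far_end (hK _ hn) hι hηR (hband _) h1 h2 with h | h
      · exact ⟨a m, n, le_rfl, han, hnb, Or.inr ⟨h, hK _ hn⟩⟩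
      · exact ⟨n, b m, han, hnb, le_rfl, Or.inl ⟨hK _ hn, h⟩⟩
    · rcases far_end (hK _ hn) hι hηR (hband _) h2 h1 with h | h
      · exact ⟨n, b m, han, hnb, le_rfl, Or.inl ⟨hK _ hn, h⟩⟩
      · exact ⟨a m, n, le_rfl, han, hnb, Or.inr ⟨h, hK _ hn⟩⟩
  choose! i j hi hij hj hs using key
  have hW : HasSepWindows (meshPoint δ) p F.card 0 p.length c ι η :=
    hasSepWindows_of_finset F _ p i j (fun m hm => ⟨Nat.zero_le _, hij m hm, (hj m hm).trans (hb m)⟩)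
      hs fun m hm m' hm' hmm' => (hj m hm).trans_lt ((hsep hmm').trans_le (hi m' hm'))
  by_contra hle
  exact hg (hasTraversals_of_hasSepWindows δ G u v p g c ι η (hW.of_le (not_lt.1 hle)))

/-- **Far blob-pieces are charged to the germ shell.**  Pieces whose left end lies in the blob `K`
(within `ι` of `c`) and which have an interior index at distance `≥ η` from `c` carry strictly
separated windows across the germ shell `D(c; ι, η)` (pieces are disjoint); so fewer than `g` of
them, unless the mesh polyline makes `g` separate traversals of the germ shell. [folklore] -/
private theorem ncard_blobPieces_lt (p : G.Walk u v) {Sp : Set (Site 2)} {c : ℂ} {ι η : ℝ} {g : ℕ}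
    (K : Finset (Site 2)) (hK : ∀ k ∈ K, dist (meshPoint δ k) c ≤ ι)
    (hg : ¬ (⟨p.toCurve (meshPoint δ)⟩ : Curve ℂ).HasTraversals g c ι η) :
    {i : ℕ | ∃ j, IsPiece p Sp i j ∧ p.getVert i ∈ K ∧
      ∃ n, i < n ∧ n < j ∧ η ≤ dist (meshPoint δ (p.getVert n)) c}.ncard < g := by
  refine ncard_lt_of_forall_finset ((Set.finite_le_nat p.length).subset fun i hi => ?_)
    (P := fun k => HasSepWindows (meshPoint δ) p k 0 p.length c ι η) (fun T hT => ?_)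
    fun h => hg (hasTraversals_of_hasSepWindows δ G u v p g c ι η h)
  · obtain ⟨j, hij, -⟩ := hi
    exact hij.1.1
  · have key : ∀ i ∈ T, ∃ j n, IsPiece p Sp i j ∧ p.getVert i ∈ K ∧ i < n ∧ n < j ∧
        η ≤ dist (meshPoint δ (p.getVert n)) c := fun i hi => by
      obtain ⟨j, hij, hiK, n, hin, hnj, hn⟩ := hT (Finset.mem_coe.2 hi)
      exact ⟨j, n, hij, hiK, hin, hnj, hn⟩
    choose! j n hpiece hKi hin hnj hfar using key
    exact hasSepWindows_of_finset T _ p id n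
      (fun i hi => ⟨Nat.zero_le _, (hin i hi).le, (hnj i hi).le.trans (hpiece i hi).2.1.1⟩)
      (fun i hi => Or.inl ⟨hK _ (hKi i hi), hfar i hi⟩) fun i hi i' hi' hii' =>
        (hnj i hi).trans_le (isPiece_le_of_lt (hpiece i hi) (hpiece i' hi') hii')

/-- **A spine-free window lies in a far piece.**  For a sub-graph of `ℤ²` at mesh `δ > 0`
(`ρ + 2δ < R - 2δ`), an index window across `D(x; ρ + δ, R - δ)` containing no spine index lies
strictly inside a piece, and that piece has an interior index whose site lies in the closed band of
`D(x; ρ, R)` (discrete intermediate value, the distance to `x` moving by `≤ δ` per step), hence at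
distance `≥ 2η ≥ η` from both marked centres: the piece is far. [folklore] -/
private theorem exists_farPiece_of_window (p : G.Walk u v) (hG : G ≤ zdGraph 2) (hδ : 0 < δ)
    {Sp S : Set (Site 2)} {x ca cb : ℂ} {ρ R η : ℝ} (h0 : p.getVert 0 ∈ Sp)
    (hlen : p.getVert p.length ∈ Sp) (hρR : ρ + 2 * δ < R - 2 * δ) (hη : 0 ≤ η)
    (hband : ∀ z : ℂ, ρ ≤ dist z x → dist z x ≤ R → 2 * η ≤ dist z ca ∧ 2 * η ≤ dist z cb)
    {a b : ℕ} (hab : a ≤ b) (hb : b ≤ p.length)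
    (hside : (dist (meshPoint δ (p.getVert a)) x ≤ ρ + δ ∧ R - δ ≤ dist (meshPoint δ (p.getVert b)) x) ∨
      (R - δ ≤ dist (meshPoint δ (p.getVert a)) x ∧ dist (meshPoint δ (p.getVert b)) x ≤ ρ + δ))
    (hpure : ∀ n, a ≤ n → n ≤ b → p.getVert n ∉ Sp) :
    ∃ i j, IsFarPiece (meshPoint δ) p Sp S i j ca cb η ∧ i < a ∧ b < j := by
  obtain ⟨i, j, hpiece, hia, hbj⟩ := exists_piece_of_window p h0 hlen hab hb hpure
  obtain ⟨i', j', hi', hi'j', hj', hs', hint⟩ :=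
    exists_tight_indices (d := fun n => dist (meshPoint δ (p.getVert n)) x) (r := ρ + δ) (R := R - δ)
      (by linarith) hab hside
  -- the crossing takes at least two steps: one step moves the distance to `x` by at most `δ`
  have hstep : i' + 1 < j' := by
    by_contra h
    have hj'eq : j' = i' + 1 := by omega
    have hadj := dist_meshPoint_le_of_le_zdGraph hG hδ.le
      (p.adj_getVert_succ (i := i') (by omega))
    have t1 := dist_triangle (meshPoint δ (p.getVert i')) (meshPoint δ (p.getVert (i' + 1))) x
    have t2 := dist_triangle (meshPoint δ (p.getVert (i' + 1))) (meshPoint δ (p.getVert i')) x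
    have e1 := dist_comm (meshPoint δ (p.getVert i')) (meshPoint δ (p.getVert (i' + 1)))
    rw [hj'eq] at hs'
    rcases hs' with ⟨h1, h2⟩ | ⟨h1, h2⟩ <;> linarith
  obtain ⟨h1, h2⟩ := hint (i' + 1) (Nat.lt_succ_self _) hstep
  obtain ⟨hfa, hfb⟩ := hband _ (by linarith) (by linarith)
  exact ⟨i, j, ⟨hpiece, Or.inr (Or.inr ⟨i' + 1, by omega, by omega, by linarith, by linarith⟩)⟩, hia, hbj⟩

/-- **Registered stub `stub_necklaceBookkeeping`** (crux stmt-CriticalPhenomena-1878, line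
`slit-necklace`, reshape r3, chart r2 step D3): **the necklace bookkeeping.**  For a self-avoiding
lattice walk from the blob `Ka` to the blob `Kb`, spine `Ka ∪ Kb ∪ S`, `#S ≤ N₀`, and a shell
`D(x; ρ, R)` whose closed band is `2η`-far from both marked centres, `2(N₀ + 2g + (2N₀ + 2g) n₁ + 1)`
separate traversals of the shell by the mesh polyline force `g` separate traversals of one of the
germ shells, or fewer than `2N₀ + 2g` far pieces one of which carries `n₁ + 1` strictly separated
index windows across `D(x; ρ + δ, R - δ)` strictly inside itself. [folklore] -/
theorem stub_necklaceBookkeeping : NecklaceBookkeeping := by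
  intro δ G u v p Ka Kb S ca cb x ιa ιb ρ R η g n₁ N₀ hG hp hδ hu hv hKa hKb hS hιa hιb hηR hρR hband hT
  classical
  rcases Nat.eq_zero_or_pos g with rfl | hg
  · exact Or.inl (Curve.hasTraversals_zero _ _ _ _)
  by_cases h1 : (⟨p.toCurve (meshPoint δ)⟩ : Curve ℂ).HasTraversals g ca ιa η
  · exact Or.inl h1
  by_cases h2 : (⟨p.toCurve (meshPoint δ)⟩ : Curve ℂ).HasTraversals g cb ιb η
  · exact Or.inr (Or.inl h2)
  refine Or.inr (Or.inr ?_)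
  set Sp : Set (Site 2) := ↑(Ka ∪ Kb ∪ S) with hSp
  have hmemSp : ∀ z, z ∈ Sp ↔ (z ∈ Ka ∨ z ∈ Kb) ∨ z ∈ S := fun z => by
    rw [hSp, Finset.mem_coe, Finset.mem_union, Finset.mem_union]
  have hη : 0 ≤ η := (dist_nonneg.trans (hKa u hu)).trans hιa.le
  have h0 : p.getVert 0 ∈ Sp := by rw [p.getVert_zero, hmemSp]; exact Or.inl (Or.inl hu)
  have hlen : p.getVert p.length ∈ Sp := by rw [p.getVert_length, hmemSp]; exact Or.inl (Or.inr hv)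
  -- (1) strictly separated index windows across `D(x; ρ + δ, R - δ)`
  obtain ⟨a, b, hab, hb, hside, hsep⟩ := exists_sepIndexTraversals_of_hasTraversals_toCurve (ε := δ)
    hδ.le (meshPoint δ) (dist_meshPoint_le_of_le_zdGraph hG hδ.le) p (r' := ρ + δ) (R' := R - δ)
    le_rfl le_rfl (by linarith) hT
  -- (2) classification of the windows
  set FS : Finset (Fin _) := Finset.univ.filter fun m => ∃ n, a m ≤ n ∧ n ≤ b m ∧ p.getVert n ∈ S
  set FA : Finset (Fin _) := Finset.univ.filter fun m => ∃ n, a m ≤ n ∧ n ≤ b m ∧ p.getVert n ∈ Ka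
  set FB : Finset (Fin _) := Finset.univ.filter fun m => ∃ n, a m ≤ n ∧ n ≤ b m ∧ p.getVert n ∈ Kb
  set FP : Finset (Fin _) := Finset.univ.filter fun m => ∀ n, a m ≤ n → n ≤ b m → p.getVert n ∉ Sp
  have hcover : Finset.univ ⊆ FS ∪ FA ∪ FB ∪ FP := by
    intro m _
    simp only [FS, FA, FB, FP, Finset.mem_union, Finset.mem_filter, Finset.mem_univ, true_and]
    by_cases hP : ∀ n, a m ≤ n → n ≤ b m → p.getVert n ∉ Sp
    · exact Or.inr hP
    push Not at hP
    obtain ⟨n, han, hnb, hn⟩ := hP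
    rcases (hmemSp _).1 hn with (h | h) | h
    · exact Or.inl (Or.inl (Or.inr ⟨n, han, hnb, h⟩))
    · exact Or.inl (Or.inr ⟨n, han, hnb, h⟩)
    · exact Or.inl (Or.inl (Or.inl ⟨n, han, hnb, h⟩))
  have hFS : FS.card ≤ N₀ :=
    (card_defectWindows_le hp hb hsep S FS fun m hm => (Finset.mem_filter.1 hm).2).trans hS
  have hFA : FA.card < g := card_blobWindows_lt p Ka hb hside hsep hKa hιa hηR
    (fun z hz hz' => (hband z hz hz').1) h1 FA fun m hm => (Finset.mem_filter.1 hm).2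
  have hFB : FB.card < g := card_blobWindows_lt p Kb hb hside hsep hKb hιb hηR
    (fun z hz hz' => (hband z hz hz').2) h2 FB fun m hm => (Finset.mem_filter.1 hm).2
  have hFP : (2 * N₀ + 2 * g) * n₁ + 3 ≤ FP.card := by
    have hM := Finset.card_le_card hcover
    rw [Finset.card_univ, Fintype.card_fin] at hM
    have hu1 := Finset.card_union_le (FS ∪ FA ∪ FB) FP
    have hu2 := Finset.card_union_le (FS ∪ FA) FB
    have hu3 := Finset.card_union_le FS FA
    omega
  -- (4) far pieces are few
  set Far : Set ℕ := {i : ℕ | ∃ j, IsFarPiece (meshPoint δ) p Sp ↑S i j ca cb η} with hFar_def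
  have hFar_fin : Far.Finite := (Set.finite_le_nat p.length).subset fun i hi => by
    obtain ⟨j, hij, -⟩ := hi
    exact hij.1.1
  have hFar : Far.ncard < 2 * N₀ + 2 * g := by
    have hA : {i : ℕ | i ≤ p.length ∧ p.getVert i ∈ S}.ncard ≤ N₀ := by
      refine (Set.ncard_le_ncard_of_injOn (fun i => p.getVert i) (t := (↑S : Set (Site 2)))
        (fun i hi => hi.2) (fun i hi i' hi' h => hp.getVert_injOn hi.1 hi'.1 h) S.finite_toSet).trans ?_
      rw [Set.ncard_coe_finset]
      exact hS
    have hB : {i : ℕ | ∃ j, IsPiece p Sp i j ∧ p.getVert j ∈ S}.ncard ≤ N₀ := by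
      have key : ∀ i ∈ {i : ℕ | ∃ j, IsPiece p Sp i j ∧ p.getVert j ∈ S},
          ∃ j, IsPiece p Sp i j ∧ p.getVert j ∈ S := fun i hi => hi
      choose! jf hjf using key
      refine (Set.ncard_le_ncard_of_injOn (fun i => p.getVert (jf i)) (t := (↑S : Set (Site 2)))
        (fun i hi => (hjf i hi).2) (fun i hi i' hi' h => ?_) S.finite_toSet).trans ?_
      · have h' : jf i = jf i' := hp.getVert_injOn (hjf i hi).1.2.1.1 (hjf i' hi').1.2.1.1 h
        have hpi := (hjf i hi).1
        rw [h'] at hpi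
        exact isPiece_left_unique hpi (hjf i' hi').1
      · rw [Set.ncard_coe_finset]
        exact hS
    have hCa := ncard_blobPieces_lt (Sp := Sp) (η := η) p Ka hKa h1
    have hCb := ncard_blobPieces_lt (Sp := Sp) (η := η) p Kb hKb h2
    have hsub : Far ⊆ {i : ℕ | i ≤ p.length ∧ p.getVert i ∈ S} ∪
        {i : ℕ | ∃ j, IsPiece p Sp i j ∧ p.getVert j ∈ S} ∪
        {i : ℕ | ∃ j, IsPiece p Sp i j ∧ p.getVert i ∈ Ka ∧
          ∃ n, i < n ∧ n < j ∧ η ≤ dist (meshPoint δ (p.getVert n)) ca} ∪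
        {i : ℕ | ∃ j, IsPiece p Sp i j ∧ p.getVert i ∈ Kb ∧
          ∃ n, i < n ∧ n < j ∧ η ≤ dist (meshPoint δ (p.getVert n)) cb} := by
      rintro i ⟨j, hpiece, hiS | hjS | ⟨n, hin, hnj, hna, hnb⟩⟩
      · exact Or.inl (Or.inl (Or.inl ⟨hpiece.1.1, hiS⟩))
      · exact Or.inl (Or.inl (Or.inr ⟨j, hpiece, hjS⟩))
      · rcases (hmemSp _).1 hpiece.1.2 with (hi | hi) | hi
        · exact Or.inl (Or.inr ⟨j, hpiece, hi, n, hin, hnj, hna⟩)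
        · exact Or.inr ⟨j, hpiece, hi, n, hin, hnj, hnb⟩
        · exact Or.inl (Or.inl (Or.inl ⟨hpiece.1.1, hi⟩))
    -- the union is finite (all indices `≤ p.length`) and a union bound finishes
    refine (Set.ncard_le_ncard hsub ((Set.finite_le_nat p.length).subset ?_)).trans_lt ?_
    · rintro i (((hi | ⟨j, hij, -⟩) | ⟨j, hij, -⟩) | ⟨j, hij, -⟩)
      exacts [hi.1, hij.1.1, hij.1.1, hij.1.1]
    refine (Set.ncard_union_le _ _).trans_lt ?_
    refine (Nat.add_le_add_right (Set.ncard_union_le _ _) _).trans_lt ?_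
    refine (Nat.add_le_add_right (Nat.add_le_add_right (Set.ncard_union_le _ _) _) _).trans_lt ?_
    omega
  refine ⟨hFar, ?_⟩
  -- (3) + (5) the spine-free windows lie in far pieces; pigeonhole
  have key : ∀ m ∈ FP, ∃ i j, IsFarPiece (meshPoint δ) p Sp ↑S i j ca cb η ∧ i < a m ∧ b m < j :=
    fun m hm => exists_farPiece_of_window p hG hδ h0 hlen hρR hη hband (hab m) (hb m) (hside m)
      (Finset.mem_filter.1 hm).2
  choose! fi fj hfar hia hbj using key
  obtain ⟨y, hy, hfib⟩ := Finset.exists_lt_card_fiber_of_mul_lt_card_of_maps_to (s := FP)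
    (t := hFar_fin.toFinset) (f := fi) (n := n₁)
    (fun m hm => hFar_fin.mem_toFinset.2 ⟨fj m, hfar m hm⟩) (by
      rw [← Set.ncard_eq_toFinset_card Far hFar_fin]
      have := Nat.mul_le_mul_right n₁ hFar.le
      omega)
  obtain ⟨j, hyj⟩ := hFar_fin.mem_toFinset.1 hy
  refine ⟨y, j, hyj, ?_⟩
  have hW : HasSepWindows (meshPoint δ) p (FP.filter fun m => fi m = y).card (y + 1) (j - 1) x
      (ρ + δ) (R - δ) := by
    refine hasSepWindows_of_finset _ _ p a b (fun m hm => ?_) (fun m _ => hside m)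
      fun m _ m' _ hmm' => hsep hmm'
    obtain ⟨hm, hmy⟩ := Finset.mem_filter.1 hm
    have hi := hia m hm
    have hj := hbj m hm
    have hpm := (hfar m hm).1
    rw [hmy] at hi hpm
    have hjj : fj m = j := isPiece_right_unique hpm hyj.1
    have := hab m
    omega
  exact hW.of_le hfib

end Summit.CriticalPhenomena.SAWScalingLimit.Theorems.FKGToTraversalBound.SlitNecklace

end
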